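import Summits.CriticalPhenomena.CardyFormulaZ2.Theorems.CardyBoundaryCoulombGasBoundaryDefectGaussianRStubRigidityOfLocalLawsPart1

/-!
# Stub `stub_rigidity_of_local_laws` of line `rainbow-monomials-in-excursion-kernels` — Part 2:
# abstract rigidity from the local laws (two domains glued by cluster locality)

Crux `BoundaryDefectGaussianR` (stmt-CriticalPhenomena-14132). Continues Part 1: `s3_slots` (the
common cluster slots `x i = i⌈r/δ_n⌉`, strictly increasing, `r/δ_n`-separated, within `s/δ_n`) and
`s3_rigidityAbstract`: TRANSPORT + REAL + POINT TRANSPORT + CLUSTER LOCALITY ⇒ RIGIDITY, for abstract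
`Adm / P / F` and abstract domain predicates (`Rect`, flat marks `FM`, orientation `OR`, lattice
approximation `LA`, convergence `CV` — they are only threaded through). Order of choices for the
limit: `ε → M(ε/4)` (cluster locality) `→ s = min(s₀,s₀')/(M+1)` (cluster radius, so that the flat
anchor environments of radius `s₀/δ_n` contain the `M·s/δ_n`-balls) `→ r = min(r₀, r₀', s/(2k+2))`
(separation, so that `k` slots fit) `→` Part 1 in each domain `→` glue the two clusters, which are
translates of each other, by cluster locality.
-/

noncomputable section

open Filter Topology

namespace Summit.CriticalPhenomena.CardyFormulaZ2.Cruxes.BoundaryDefectGaussianR.RainbowMonomialsInExcursionKernels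

/-- **Cluster slots.** For `0 < r` with `r·(2k+2) ≤ s`, eventually along a mesh sequence `δ_n → 0⁺`
the slots `x i = i·⌈r/δ_n⌉` are strictly increasing, pairwise `r/δ_n`-separated and within `s/δ_n`
of the anchor. [folklore] -/
theorem s3_slots :
    ∀ (k : ℕ) (δ : ℕ → ℝ), (∀ n, 0 < δ n) → (Filter.Tendsto δ Filter.atTop (nhds 0)) → ∀ (r s : ℝ), (0 < r)
    → (r * (2 * k + 2) ≤ s) → ∀ᶠ n in Filter.atTop, ∃ x : Fin k → ℤ, StrictMono x ∧ (∀ i₁ i₂ : Fin k, i₁ ≠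
    i₂ → (r / δ n) ^ 2 ≤ (((x i₁ - x i₂) ^ 2 : ℤ) : ℝ)) ∧ (∀ i, (((x i) ^ 2 : ℤ) : ℝ) ≤ (s / δ n) ^ 2) := by
  intro k δ hδ hδ0 r s hr hrs
  filter_upwards [hδ0.eventually (eventually_le_nhds hr)] with n hn
  have hδn := hδ n
  have hq : 1 ≤ r / δ n := (one_le_div hδn).2 hn
  have hq0 : 0 ≤ r / δ n := by positivity
  set c : ℕ := ⌈r / δ n⌉₊ with hc
  have hc1 : r / δ n ≤ (c : ℝ) := Nat.le_ceil _
  have hc2 : (c : ℝ) < r / δ n + 1 := Nat.ceil_lt_add_one hq0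
  have hcpos : 0 < c := Nat.ceil_pos.2 (by positivity)
  refine ⟨fun i ↦ (((i : ℕ) * c : ℕ) : ℤ), ?_, ?_, ?_⟩
  · intro i₁ i₂ h
    have h' : (i₁ : ℕ) < (i₂ : ℕ) := h
    have : (i₁ : ℕ) * c < (i₂ : ℕ) * c := Nat.mul_lt_mul_of_pos_right h' hcpos
    show (((i₁ : ℕ) * c : ℕ) : ℤ) < (((i₂ : ℕ) * c : ℕ) : ℤ)
    exact_mod_cast this
  · intro i₁ i₂ hne
    have hne' : ((i₁ : ℕ) : ℝ) ≠ ((i₂ : ℕ) : ℝ) := by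
      intro h
      exact hne (Fin.ext (by exact_mod_cast h))
    have h1 : (1 : ℝ) ≤ (((i₁ : ℕ) : ℝ) - ((i₂ : ℕ) : ℝ)) ^ 2 := by
      rcases lt_or_gt_of_ne hne' with h | h
      · have : ((i₁ : ℕ) : ℝ) + 1 ≤ ((i₂ : ℕ) : ℝ) := by
          have : (i₁ : ℕ) < (i₂ : ℕ) := by exact_mod_cast h
          exact_mod_cast this
        nlinarith
      · have : ((i₂ : ℕ) : ℝ) + 1 ≤ ((i₁ : ℕ) : ℝ) := by
          have : (i₂ : ℕ) < (i₁ : ℕ) := by exact_mod_cast h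
          exact_mod_cast this
        nlinarith
    push_cast
    calc (r / δ n) ^ 2 ≤ (c : ℝ) ^ 2 := pow_le_pow_left₀ hq0 hc1 2
      _ ≤ (((i₁ : ℕ) : ℝ) - ((i₂ : ℕ) : ℝ)) ^ 2 * (c : ℝ) ^ 2 :=
          le_mul_of_one_le_left (by positivity) h1
      _ = (((i₁ : ℕ) : ℝ) * c - ((i₂ : ℕ) : ℝ) * c) ^ 2 := by ring
  · intro i
    have hi : ((i : ℕ) : ℝ) ≤ k := by exact_mod_cast i.2.le
    have hi0 : (0 : ℝ) ≤ ((i : ℕ) : ℝ) := by positivity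
    have hc3 : (c : ℝ) ≤ 2 * (r / δ n) := by linarith
    have hks : 2 * k * r ≤ s := by nlinarith
    push_cast
    calc (((i : ℕ) : ℝ) * c) ^ 2 ≤ ((k : ℝ) * (2 * (r / δ n))) ^ 2 := by
          apply pow_le_pow_left₀ (by positivity)
          exact mul_le_mul hi hc3 (by positivity) (by positivity)
      _ = (2 * k * r / δ n) ^ 2 := by ring
      _ ≤ (s / δ n) ^ 2 := by
          apply pow_le_pow_left₀ (by positivity)
          exact div_le_div_of_nonneg_right hks hδn.le

/-- **Rigidity from the local laws, abstract form.** For abstract admissibility `Adm`, probability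
`P`, functional `F` and abstract domain predicates (`Rect`, `FM` flat marks, `OR` orientation at the
sink, `LA` lattice approximation, `CV` convergence of the configurations to the marks): TRANSPORT
(admissible transport paths into a flat bottom-type cluster, uniformly over the admissible cluster
slots) + REAL (realisability: positivity of `P` on flat separated admissible data) + POINT TRANSPORT
(unit slides `o(δ)`, `ρ`-jumps `o_ρ(1)`) + CLUSTER LOCALITY give RIGIDITY: eventual positivity and
`F_{V_n}(p_n) - F_{V'_n}(p'_n) → 0`. Proof: one-domain estimates (`rig_oneDomain`) in `D` and `D'`
towards the SAME slots `x i = i⌈r/δ_n⌉` (`rig_slots`), glued by cluster locality at the anchors. [folklore] -/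
theorem s3_rigidityAbstract :
    ∀ {k : ℕ} (Adm : Finset (ℤ × ℤ) → (Fin k → ℤ × ℤ) → Prop) (P F : Finset (ℤ × ℤ) → (Fin k → ℤ × ℤ) → ℝ)
    (Rect : Literature.Probability.RandomPlanarGeometry.JordanDomain → Prop) (FM OR :
    Literature.Probability.RandomPlanarGeometry.MarkedDomain k → Prop) (LA :
    Literature.Probability.RandomPlanarGeometry.JordanDomain → (ℕ → ℝ) → (ℕ → Finset (ℤ × ℤ)) → Prop) (CV :
    Literature.Probability.RandomPlanarGeometry.MarkedDomain k → (ℕ → ℝ) → (ℕ → Fin k → ℤ × ℤ) → Prop), (∀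
    (D : Literature.Probability.RandomPlanarGeometry.MarkedDomain k), Rect D.toJordanDomain → FM D → OR D →
    ∀ (δ : ℕ → ℝ), (∀ n, 0 < δ n) → Filter.Tendsto δ Filter.atTop (nhds 0) → ∀ (V : ℕ → Finset (ℤ × ℤ)), LA
    D.toJordanDomain δ V → ∀ (p : ℕ → Fin k → ℤ × ℤ), (∀ n, Function.Injective ((p) n)) → CV D δ p → (∀ n,
    Adm (V n) (p n)) → ∃ (a : ℕ → ℤ × ℤ) (s₀ r₀ : ℝ) (N : ℕ), 0 < s₀ ∧ 0 < r₀ ∧ (∀ᶠ n in Filter.atTop, ∀ v :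
    ℤ × ℤ, (((((v).1 - (a n).1) ^ 2 + ((v).2 - (a n).2) ^ 2 : ℤ) : ℝ)) ≤ (s₀ / δ n) ^ 2 → (v ∈ V n ↔ 0 ≤ v.2
    - (a n).2)) ∧ ∀ r : ℝ, 0 < r → r ≤ r₀ → ∀ ρ : ℝ, 0 < ρ → ρ ≤ r → ∀ᶠ n in Filter.atTop, ∀ x : Fin k → ℤ,
    StrictMono x → (∀ i₁ i₂ : Fin k, i₁ ≠ i₂ → (r / δ n) ^ 2 ≤ (((x i₁ - x i₂) ^ 2 : ℤ) : ℝ)) → (∀ i, (((x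
    i) ^ 2 : ℤ) : ℝ) ≤ (s₀ / δ n) ^ 2) → ∃ (T : ℕ) (q : ℕ → Fin k → ℤ × ℤ) (σ : ℕ → Bool), q 0 = p n ∧ (q T
    = fun i ↦ ((a n).1 + x i, (a n).2)) ∧ (T : ℝ) * δ n ≤ N ∧ ((Finset.range T).filter (fun t ↦ σ t =
    false)).card ≤ N ∧ (∀ t, t ≤ T → Function.Injective (q t) ∧ Adm (V n) (q t) ∧ (∀ i, ∃ d : ℤ × ℤ, (d =
    (1, 0) ∨ d = (-1, 0) ∨ d = (0, 1) ∨ d = (0, -1)) ∧ ∀ v : ℤ × ℤ, (((((v).1 - (q t i).1) ^ 2 + ((v).2 - (q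
    t i).2) ^ 2 : ℤ) : ℝ)) ≤ (ρ / 4 / δ n) ^ 2 → (v ∈ V n ↔ 0 ≤ (v.1 - (q t i).1) * d.1 + (v.2 - (q t i).2)
    * d.2)) ∧ (∀ i₁ i₂ : Fin k, i₁ ≠ i₂ → (r / δ n) ^ 2 ≤ ((((((q t) i₁).1 - ((q t) i₂).1) ^ 2 + (((q t)
    i₁).2 - ((q t) i₂).2) ^ 2 : ℤ) : ℝ)))) ∧ (∀ t, t < T → (σ t = true → ∃ (i : Fin k) (τ : ℤ × ℤ), (τ = (1,
    0) ∨ τ = (-1, 0) ∨ τ = (0, 1) ∨ τ = (0, -1)) ∧ q (t + 1) = Function.update (q t) i (q t i + τ)) ∧ (σ t =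
    false → ∃ (i : Fin k) (q' : ℤ × ℤ), q (t + 1) = Function.update (q t) i q' ∧ (∀ i', i' ≠ i → ∃ d : ℤ ×
    ℤ, (d = (1, 0) ∨ d = (-1, 0) ∨ d = (0, 1) ∨ d = (0, -1)) ∧ ∀ v : ℤ × ℤ, (((((v).1 - (q t i').1) ^ 2 +
    ((v).2 - (q t i').2) ^ 2 : ℤ) : ℝ)) ≤ (r / δ n) ^ 2 → (v ∈ V n ↔ 0 ≤ (v.1 - (q t i').1) * d.1 + (v.2 -
    (q t i').2) * d.2)) ∧ (((((q').1 - (q t i).1) ^ 2 + ((q').2 - (q t i).2) ^ 2 : ℤ) : ℝ)) ≤ (ρ / δ n) ^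
    2))) → (∀ (D : Literature.Probability.RandomPlanarGeometry.JordanDomain), Rect D → ∀ (r : ℝ), 0 < r → ∀
    (δ : ℕ → ℝ), (∀ n, 0 < δ n) → Filter.Tendsto δ Filter.atTop (nhds 0) → ∀ (V : ℕ → Finset (ℤ × ℤ)), LA D
    δ V → ∀ᶠ n in Filter.atTop, ∀ (p : Fin k → ℤ × ℤ), Function.Injective p → Adm (V n) p → (∀ i', ∃ d : ℤ ×
    ℤ, (d = (1, 0) ∨ d = (-1, 0) ∨ d = (0, 1) ∨ d = (0, -1)) ∧ ∀ v : ℤ × ℤ, (((((v).1 - (p i').1) ^ 2 +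
    ((v).2 - (p i').2) ^ 2 : ℤ) : ℝ)) ≤ (r / δ n) ^ 2 → (v ∈ V n ↔ 0 ≤ (v.1 - (p i').1) * d.1 + (v.2 - (p
    i').2) * d.2)) → (∀ i₁ i₂ : Fin k, i₁ ≠ i₂ → (r / δ n) ^ 2 ≤ ((((((p) i₁).1 - ((p) i₂).1) ^ 2 + (((p)
    i₁).2 - ((p) i₂).2) ^ 2 : ℤ) : ℝ))) → 0 < P (V n) p) → ((∀ (D :
    Literature.Probability.RandomPlanarGeometry.JordanDomain), Rect D → ∀ (r ε : ℝ), 0 < r → 0 < ε → ∀ (δ :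
    ℕ → ℝ), (∀ n, 0 < δ n) → Filter.Tendsto δ Filter.atTop (nhds 0) → ∀ (V : ℕ → Finset (ℤ × ℤ)), LA D δ V →
    ∀ᶠ n in Filter.atTop, ∀ (p : Fin k → ℤ × ℤ) (i : Fin k) (τ : ℤ × ℤ), (τ = (1, 0) ∨ τ = (-1, 0) ∨ τ = (0,
    1) ∨ τ = (0, -1)) → Function.Injective p → Function.Injective (Function.update p i (p i + τ)) → Adm (V
    n) p → Adm (V n) (Function.update p i (p i + τ)) → 0 < P (V n) p → 0 < P (V n) (Function.update p i (p i
    + τ)) → (∀ i', ∃ d : ℤ × ℤ, (d = (1, 0) ∨ d = (-1, 0) ∨ d = (0, 1) ∨ d = (0, -1)) ∧ ∀ v : ℤ × ℤ,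
    (((((v).1 - (p i').1) ^ 2 + ((v).2 - (p i').2) ^ 2 : ℤ) : ℝ)) ≤ (r / δ n) ^ 2 → (v ∈ V n ↔ 0 ≤ (v.1 - (p
    i').1) * d.1 + (v.2 - (p i').2) * d.2)) → (∀ i₁ i₂ : Fin k, i₁ ≠ i₂ → (r / δ n) ^ 2 ≤ ((((((p) i₁).1 -
    ((p) i₂).1) ^ 2 + (((p) i₁).2 - ((p) i₂).2) ^ 2 : ℤ) : ℝ))) → |F (V n) (Function.update p i (p i + τ)) -
    F (V n) p| ≤ ε * δ n) ∧ (∀ (D : Literature.Probability.RandomPlanarGeometry.JordanDomain), Rect D → ∀ (r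
    ε : ℝ), 0 < r → 0 < ε → ∃ ρ : ℝ, 0 < ρ ∧ ρ ≤ r ∧ ∀ (δ : ℕ → ℝ), (∀ n, 0 < δ n) → Filter.Tendsto δ
    Filter.atTop (nhds 0) → ∀ (V : ℕ → Finset (ℤ × ℤ)), LA D δ V → ∀ᶠ n in Filter.atTop, ∀ (p : Fin k → ℤ ×
    ℤ) (i : Fin k) (q : ℤ × ℤ), Function.Injective p → Function.Injective (Function.update p i q) → Adm (V
    n) p → Adm (V n) (Function.update p i q) → 0 < P (V n) p → 0 < P (V n) (Function.update p i q) → (∀ i',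
    i' ≠ i → ∃ d : ℤ × ℤ, (d = (1, 0) ∨ d = (-1, 0) ∨ d = (0, 1) ∨ d = (0, -1)) ∧ ∀ v : ℤ × ℤ, (((((v).1 -
    (p i').1) ^ 2 + ((v).2 - (p i').2) ^ 2 : ℤ) : ℝ)) ≤ (r / δ n) ^ 2 → (v ∈ V n ↔ 0 ≤ (v.1 - (p i').1) *
    d.1 + (v.2 - (p i').2) * d.2)) → (∃ d : ℤ × ℤ, (d = (1, 0) ∨ d = (-1, 0) ∨ d = (0, 1) ∨ d = (0, -1)) ∧ ∀
    v : ℤ × ℤ, (((((v).1 - (p i).1) ^ 2 + ((v).2 - (p i).2) ^ 2 : ℤ) : ℝ)) ≤ (ρ / 4 / δ n) ^ 2 → (v ∈ V n ↔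
    0 ≤ (v.1 - (p i).1) * d.1 + (v.2 - (p i).2) * d.2)) → (∃ d : ℤ × ℤ, (d = (1, 0) ∨ d = (-1, 0) ∨ d = (0,
    1) ∨ d = (0, -1)) ∧ ∀ v : ℤ × ℤ, (((((v).1 - (q).1) ^ 2 + ((v).2 - (q).2) ^ 2 : ℤ) : ℝ)) ≤ (ρ / 4 / δ n)
    ^ 2 → (v ∈ V n ↔ 0 ≤ (v.1 - (q).1) * d.1 + (v.2 - (q).2) * d.2)) → (∀ i₁ i₂ : Fin k, i₁ ≠ i₂ → (r / δ n)
    ^ 2 ≤ ((((((p) i₁).1 - ((p) i₂).1) ^ 2 + (((p) i₁).2 - ((p) i₂).2) ^ 2 : ℤ) : ℝ))) → (∀ i₁ i₂ : Fin k,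
    i₁ ≠ i₂ → (r / δ n) ^ 2 ≤ (((((((Function.update p i q)) i₁).1 - (((Function.update p i q)) i₂).1) ^ 2 +
    ((((Function.update p i q)) i₁).2 - (((Function.update p i q)) i₂).2) ^ 2 : ℤ) : ℝ))) → (((((q).1 - (p
    i).1) ^ 2 + ((q).2 - (p i).2) ^ 2 : ℤ) : ℝ)) ≤ (ρ / δ n) ^ 2 → |F (V n) (Function.update p i q) - F (V
    n) p| ≤ ε)) → (∀ ε : ℝ, 0 < ε → ∃ M : ℝ, 0 < M ∧ ∀ (V V' : Finset (ℤ × ℤ)) (a a' : ℤ × ℤ) (m : ℝ), 1 ≤ m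
    → (∀ v : ℤ × ℤ, (((((v).1 - (a).1) ^ 2 + ((v).2 - (a).2) ^ 2 : ℤ) : ℝ)) ≤ (M * m) ^ 2 → (v ∈ V ↔ 0 ≤ v.2
    - (a).2)) → (∀ v : ℤ × ℤ, (((((v).1 - (a').1) ^ 2 + ((v).2 - (a').2) ^ 2 : ℤ) : ℝ)) ≤ (M * m) ^ 2 → (v ∈
    V' ↔ 0 ≤ v.2 - (a').2)) → ∀ (p : Fin k → ℤ × ℤ), Function.Injective p → (∀ i, (((((p i).1 - (a).1) ^ 2 +
    ((p i).2 - (a).2) ^ 2 : ℤ) : ℝ)) ≤ m ^ 2) → Adm V p → Adm V' (fun i ↦ p i - a + a') → 0 < P V p → 0 < P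
    V' (fun i ↦ p i - a + a') → |F V p - F V' (fun i ↦ p i - a + a')| ≤ ε) → ∀ (D D' :
    Literature.Probability.RandomPlanarGeometry.MarkedDomain k), Rect D.toJordanDomain → FM D → OR D → Rect
    D'.toJordanDomain → FM D' → OR D' → ∀ (δ : ℕ → ℝ), (∀ n, 0 < δ n) → Filter.Tendsto δ Filter.atTop (nhds
    0) → ∀ (V V' : ℕ → Finset (ℤ × ℤ)), LA D.toJordanDomain δ V → LA D'.toJordanDomain δ V' → ∀ (p p' : ℕ →
    Fin k → ℤ × ℤ), (∀ n, Function.Injective ((p) n)) → (∀ n, Function.Injective ((p') n)) → CV D δ p → CV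
    D' δ p' → (∀ n, Adm (V n) (p n)) → (∀ n, Adm (V' n) (p' n)) → (∀ᶠ n in Filter.atTop, 0 < P (V n) (p n))
    ∧ Filter.Tendsto (fun n ↦ F (V n) (p n) - F (V' n) (p' n)) Filter.atTop (nhds 0) := by
  intro k Adm P F Rect FM OR LA CV hT hR hPT hCL D D' hDre hDfm hDor hD're hD'fm hD'or δ hδ hδ0 V V' hV hV'
    p p' hpinj hp'inj hpcv hp'cv hpadm hp'adm
  obtain ⟨a, s₀, r₀, N, hs₀, hr₀, hanc, hTD⟩ :=
    hT D hDre hDfm hDor δ hδ hδ0 V hV p hpinj hpcv hpadm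
  obtain ⟨a', s₀', r₀', N', hs₀', hr₀', hanc', hTD'⟩ :=
    hT D' hD're hD'fm hD'or δ hδ hδ0 V' hV' p' hp'inj hp'cv hp'adm
  have hone := s3_oneDomain Adm P F δ hδ V p a s₀ r₀ N
    (fun r ε hr hε ↦ hPT.1 D.toJordanDomain hDre r ε hr hε δ hδ hδ0 V hV)
    (fun r ε hr hε ↦ by
      obtain ⟨ρ, hρ, hρr, h⟩ := hPT.2 D.toJordanDomain hDre r ε hr hε
      exact ⟨ρ, hρ, hρr, h δ hδ hδ0 V hV⟩)
    (fun r hr ↦ hR D.toJordanDomain hDre r hr δ hδ hδ0 V hV) hTD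
  have hone' := s3_oneDomain Adm P F δ hδ V' p' a' s₀' r₀' N'
    (fun r ε hr hε ↦ hPT.1 D'.toJordanDomain hD're r ε hr hε δ hδ hδ0 V' hV')
    (fun r ε hr hε ↦ by
      obtain ⟨ρ, hρ, hρr, h⟩ := hPT.2 D'.toJordanDomain hD're r ε hr hε
      exact ⟨ρ, hρ, hρr, h δ hδ hδ0 V' hV'⟩)
    (fun r hr ↦ hR D'.toJordanDomain hD're r hr δ hδ hδ0 V' hV') hTD'
  constructor
  · -- eventual positivity of `p n`: one-domain estimate at any admissible scale
    set r : ℝ := min r₀ (s₀ / (2 * k + 2)) with hr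
    have hrpos : 0 < r := lt_min hr₀ (by positivity)
    have hrr₀ : r ≤ r₀ := min_le_left _ _
    have hrs : r * (2 * k + 2) ≤ s₀ := by
      have : r ≤ s₀ / (2 * k + 2) := min_le_right _ _
      rwa [le_div_iff₀ (by positivity)] at this
    filter_upwards [hone 1 one_pos r hrpos hrr₀, s3_slots k δ hδ hδ0 r s₀ hrpos hrs] with n hn hx
    obtain ⟨x, hx1, hx2, hx3⟩ := hx
    exact (hn x hx1 hx2 hx3).2.1
  · rw [Metric.tendsto_nhds]
    intro ε hε
    have hε4 : 0 < ε / 4 := by positivity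
    obtain ⟨M, hM, hCLM⟩ := hCL (ε / 4) hε4
    set s : ℝ := min s₀ s₀' / (M + 1) with hs
    have hspos : 0 < s := by positivity
    have hsM : M * s ≤ min s₀ s₀' := by
      rw [hs, mul_div_assoc']
      rw [div_le_iff₀ (by positivity)]
      nlinarith [le_min hs₀.le hs₀'.le, min_le_left s₀ s₀']
    set r : ℝ := min (min r₀ r₀') (s / (2 * k + 2)) with hr
    have hrpos : 0 < r := lt_min (lt_min hr₀ hr₀') (by positivity)
    have hrr₀ : r ≤ r₀ := (min_le_left _ _).trans (min_le_left _ _)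
    have hrr₀' : r ≤ r₀' := (min_le_left _ _).trans (min_le_right _ _)
    have hrs : r * (2 * k + 2) ≤ s := by
      have : r ≤ s / (2 * k + 2) := min_le_right _ _
      rwa [le_div_iff₀ (by positivity)] at this
    filter_upwards [hone (ε / 4) hε4 r hrpos hrr₀, hone' (ε / 4) hε4 r hrpos hrr₀',
      s3_slots k δ hδ hδ0 r s hrpos hrs, hanc, hanc', hδ0.eventually (eventually_le_nhds hspos)]
      with n hn hn' hx hancn hancn' hδs
    obtain ⟨x, hx1, hx2, hx3⟩ := hx
    have hδn := hδ n
    have hss₀ : s ≤ s₀ := by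
      have h1 : s ≤ min s₀ s₀' := by
        rw [hs, div_le_iff₀ (by positivity)]
        nlinarith [le_min hs₀.le hs₀'.le]
      exact h1.trans (min_le_left _ _)
    have hss₀' : s ≤ s₀' := by
      have h1 : s ≤ min s₀ s₀' := by
        rw [hs, div_le_iff₀ (by positivity)]
        nlinarith [le_min hs₀.le hs₀'.le]
      exact h1.trans (min_le_right _ _)
    have hx3₀ : ∀ i, (((x i) ^ 2 : ℤ) : ℝ) ≤ (s₀ / δ n) ^ 2 := fun i ↦
      (hx3 i).trans (pow_le_pow_left₀ (by positivity) (div_le_div_of_nonneg_right hss₀ hδn.le) 2)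
    have hx3₀' : ∀ i, (((x i) ^ 2 : ℤ) : ℝ) ≤ (s₀' / δ n) ^ 2 := fun i ↦
      (hx3 i).trans (pow_le_pow_left₀ (by positivity) (div_le_div_of_nonneg_right hss₀' hδn.le) 2)
    obtain ⟨hadmc, -, hposc, hFc⟩ := hn x hx1 hx2 hx3₀
    obtain ⟨hadmc', -, hposc', hFc'⟩ := hn' x hx1 hx2 hx3₀'
    -- cluster locality between the two clusters
    set m : ℝ := s / δ n with hm
    have hm1 : 1 ≤ m := (one_le_div hδn).2 hδs
    have hMm : (M * m) ^ 2 ≤ (s₀ / δ n) ^ 2 := by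
      apply pow_le_pow_left₀ (by positivity)
      rw [hm, mul_div_assoc']
      exact div_le_div_of_nonneg_right (hsM.trans (min_le_left _ _)) hδn.le
    have hMm' : (M * m) ^ 2 ≤ (s₀' / δ n) ^ 2 := by
      apply pow_le_pow_left₀ (by positivity)
      rw [hm, mul_div_assoc']
      exact div_le_div_of_nonneg_right (hsM.trans (min_le_right _ _)) hδn.le
    have htrans : (fun i ↦ ((a n).1 + x i, (a n).2) - a n + a' n) =
        fun i ↦ ((a' n).1 + x i, (a' n).2) := by
      funext i
      ext
      · simp only [Prod.fst_add, Prod.fst_sub]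
        ring
      · simp only [Prod.snd_add, Prod.snd_sub]
        ring
    have hinjc : Function.Injective (fun i ↦ ((a n).1 + x i, (a n).2)) := by
      intro i₁ i₂ h
      have h1 : (a n).1 + x i₁ = (a n).1 + x i₂ := congrArg Prod.fst h
      exact hx1.injective (by linarith)
    have hCLn := hCLM (V n) (V' n) (a n) (a' n) m hm1
      (fun v hv ↦ hancn v (hv.trans hMm)) (fun v hv ↦ hancn' v (hv.trans hMm'))
      (fun i ↦ ((a n).1 + x i, (a n).2)) hinjc
      (fun i ↦ by
        have := hx3 i
        push_cast at this ⊢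
        rw [hm]
        nlinarith [this])
      hadmc (htrans ▸ hadmc') hposc (htrans ▸ hposc')
    rw [htrans] at hCLn
    rw [Real.dist_eq, sub_zero]
    have h3 : |F (V n) (p n) - F (V' n) (p' n)| ≤
        |F (V n) (p n) - F (V n) (fun i ↦ ((a n).1 + x i, (a n).2))| +
        |F (V n) (fun i ↦ ((a n).1 + x i, (a n).2)) - F (V' n) (fun i ↦ ((a' n).1 + x i, (a' n).2))| +
        |F (V' n) (fun i ↦ ((a' n).1 + x i, (a' n).2)) - F (V' n) (p' n)| := by
      have h1 := abs_sub_le (F (V n) (p n)) (F (V n) (fun i ↦ ((a n).1 + x i, (a n).2)))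
        (F (V' n) (p' n))
      have h2 := abs_sub_le (F (V n) (fun i ↦ ((a n).1 + x i, (a n).2)))
        (F (V' n) (fun i ↦ ((a' n).1 + x i, (a' n).2))) (F (V' n) (p' n))
      linarith
    rw [abs_sub_comm] at hFc'
    linarith

end Summit.CriticalPhenomena.CardyFormulaZ2.Cruxes.BoundaryDefectGaussianR.RainbowMonomialsInExcursionKernels

end
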